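import Summits.QuantumFields.YangMills.Theorems.PoincareLipschitzBlockLipschitzL
import Summits.QuantumFields.YangMills.Theorems.PoincareLipschitzMeanDeviationOfSecondMoment
import HarnessLib

/-!
# Crux `HistoryTailL` (stmt-QuantumFields-19936) — FILE K-16′: the K2-LANE FACE v12′ «NO CONTINUUM ROW» — the crux from K1-exp and ONE first-moment row
# (secondary face of record, ★★OWNER RULING №28; display of record = the one-row sandwich face ✓p729779)

Cell `ym3-torus` (YM ladder rung R3 = continuum SU(2) Yang–Mills on T³ — a RUNG, NOT the Clay problem: not d = 4, not infinite volume, not a mass gap);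
LEAD seat `ym-ust-19936-w1` g10.  Helper `--supports stmt-QuantumFields-19936`; THEOREMS ONLY; one-line compositions of px10 g6's LINE 27 door
✓`PoincareLipschitz.MedianCentring.historyTailL_of_expConcentration_quantile (hK1)(hLip)(hQ)` at `hLip :=` THE PROVED K2 CRUX
`PoincareLipschitzBlockLipschitzL.blockLipschitzL_proof : Theses.PoincareLipschitz.BlockLipschitzL` (stmt-QuantumFields-23533; ✓K-15 `blockLipschitzL_of_gap` at ★px19 g8's
hypothesis-free `PoincareLipschitzGapHolds.gap_holds`, itself over ★w3 g16's H-system energy gap at 3π and the whole ROAD (W) ∕ ROAD (H) ∕ LINE 25 company — credits in those files).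

THE DISPLAYED BINDERS (v12′).  `hK1` = K1-exp (crux stmt-QuantumFields-23532's exponential letter, VERBATIM since v2) and ONE first-moment row: `hQ` = (Q) (registry row,
23133's `stub_quantileDeviation`) resp. `hSM` = «BlockSecondMomentL» (OPEN, UNREGISTERED — ★★OWNER WORD 34's label).  Census v11 ✓p733775 → v12′: removed [hGap] · added [] ·
changed [].  NO continuum-analysis row and NO named Literature fact remains on the K2 lane.  NOTHING of K1-exp, (Q) or `hSM` is proved here; `HistoryTailL` is NOT proved.

WHAT IS PROVED (ns `…Theorems.PoincareLipschitzHistoryTailOfK1`).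
* ★★★ `historyTailL_of_K1_quantile (hK1) (hQ) : UnitScaleTilt.HistoryTailL` — TWO measure-side rows, nothing else.
* ★★★ `historyTailL_of_K1_secondMoment (hK1) (hSM) : UnitScaleTilt.HistoryTailL` — via ✓px9 `quantileDeviation_of_secondMoment`.
HONEST SCOPE.  Compositions by landed names only; YM₃ on T³ is rung R3, not Clay; YM gap NOT proved.

References: T. Bałaban, CMP 102 (1985) 255–275 [Balaban1985UV3]; T. Bałaban, CMP 98 (1985) 17–51 [Balaban1985Averaging]; R. Schoen, K. Uhlenbeck, Invent. Math. 78 (1984)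
[SchoenUhlenbeck1984].
-/

set_option autoImplicit false

noncomputable section

namespace Summit.QuantumFields.YangMills.Theorems.PoincareLipschitzHistoryTailOfK1

open MeasureTheory Filter Topology Finset Metric
open scoped BigOperators
open Literature.Analysis.FunctionSpaces
open Literature.MathematicalPhysics.QuantumFieldTheory.Balaban1983to89
open Literature.MathematicalPhysics.QuantumFieldTheory.Balaban1983to89.T3ContinuumYM3Torus
open Literature.MathematicalPhysics.QuantumFieldTheory.Balaban1983to89.T3UnitScaleTilt
open Literature.MathematicalPhysics.QuantumFieldTheory.Balaban1983to89.T3UnitLawDensityEML (ℰp)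
open Summit.QuantumFields.YangMills.Theorems.PoincareLipschitz.MedianCentring (historyTailL_of_expConcentration_quantile)
open Summit.QuantumFields.YangMills.Theorems.PoincareLipschitzBlockLipschitzL (blockLipschitzL_proof)
open Summit.QuantumFields.YangMills.Theorems.PoincareLipschitzMeanDeviationOfSecondMoment (quantileDeviation_of_secondMoment)

/-- ★★★ **K2-LANE FACE v12′: THE CRUX BY NAME FROM K1-exp AND THE QUANTILE ROW (Q) — the K2 row is the PROVED crux `blockLipschitzL_proof`.** [cite: Balaban1985UV3, (71) p.273; Balaban1985Averaging, Prop. 1] -/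
theorem historyTailL_of_K1_quantile
    (hK1 : ∀ (L : ℕ), ∃ (Cc cc : ℝ), 0 ≤ Cc ∧ 0 < cc ∧ ∃ γ₁ : ℝ, 0 < γ₁ ∧ γ₁ ≤ 1 ∧
      ∀ (F : T3Family) (γ : ℝ), F.L = L → 0 < γ → γ ≤ γ₁ → ∀ (K n : ℕ), 1 ≤ n →
        (n : ℝ) ≤ (F.scheme ℰp γ).β K → 2 * n ≤ (F.P K).sitesPerDir 0 →
        ∀ (x₀ : Site (F.P K) 0) (f : GaugeField (F.P K) 0 (Matrix.specialUnitaryGroup (Fin 2) ℂ) → ℝ) (Λ : ℝ), 0 < Λ →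
          Measurable f → GaugeField.GaugeInvariant f →
          (∀ U U' : GaugeField (F.P K) 0 (Matrix.specialUnitaryGroup (Fin 2) ℂ),
            (∀ b : PBond (F.P K) 0, (∀ k, (b.src k - x₀ k).val < n) → (∀ k, (b.tgt k - x₀ k).val < n) → U b = U' b) →
              f U = f U') →
          (∀ U U' : GaugeField (F.P K) 0 (Matrix.specialUnitaryGroup (Fin 2) ℂ),
            |f U - f U'| ≤ Λ * Real.sqrt (∑ b : PBond (F.P K) 0, GaugeGroup.dist1 (U b * (U' b)⁻¹) ^ 2)) →
          ∀ r : ℝ, 0 ≤ r →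
            (gibbsK F ℰp γ K).real {U | r ≤ f U - ∫ V, f V ∂(gibbsK F ℰp γ K)} ≤
              Cc * Real.exp (-(cc * Real.sqrt ((F.scheme ℰp γ).β K) * r / ((n : ℝ) * Λ))))
    (hQ : ∀ (L : ℕ) (b₀ p₀ : ℝ), 0 < b₀ → 2 < p₀ → ∃ γ₁ : ℝ, 0 < γ₁ ∧ γ₁ ≤ 1 ∧ ∀ (F : T3Family) (γ : ℝ), F.L = L → 0 < γ → γ ≤ γ₁ →
            ∀ (K j : ℕ), 1 ≤ j → j + 2 ≤ K → ∀ a : Plaq (F.P K) j,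
              3 / 4 ≤ (gibbsK F ℰp γ K).real {U : GaugeField (F.P K) 0 (Matrix.specialUnitaryGroup (Fin 2) ℂ) | GaugeGroup.dist1 (GaugeField.plaqHol (Averaging.iter (fun i' => BlockAveraging.blockAvg (P := F.P K) (j := i') ℰp) j U) a) ≤ θBal F.L γ b₀ p₀ (K - j) / 8})
    : Summit.QuantumFields.YangMills.Theses.UnitScaleTilt.HistoryTailL :=
  historyTailL_of_expConcentration_quantile hK1 blockLipschitzL_proof hQ

/-- ★★★ **THE SAME WITH ONE VARIANCE STATEMENT AS THE FIRST-MOMENT ROW.** [cite: Balaban1985UV3, (71) p.273; Balaban1985Averaging, Prop. 1] -/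
theorem historyTailL_of_K1_secondMoment
    (hK1 : ∀ (L : ℕ), ∃ (Cc cc : ℝ), 0 ≤ Cc ∧ 0 < cc ∧ ∃ γ₁ : ℝ, 0 < γ₁ ∧ γ₁ ≤ 1 ∧
      ∀ (F : T3Family) (γ : ℝ), F.L = L → 0 < γ → γ ≤ γ₁ → ∀ (K n : ℕ), 1 ≤ n →
        (n : ℝ) ≤ (F.scheme ℰp γ).β K → 2 * n ≤ (F.P K).sitesPerDir 0 →
        ∀ (x₀ : Site (F.P K) 0) (f : GaugeField (F.P K) 0 (Matrix.specialUnitaryGroup (Fin 2) ℂ) → ℝ) (Λ : ℝ), 0 < Λ →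
          Measurable f → GaugeField.GaugeInvariant f →
          (∀ U U' : GaugeField (F.P K) 0 (Matrix.specialUnitaryGroup (Fin 2) ℂ),
            (∀ b : PBond (F.P K) 0, (∀ k, (b.src k - x₀ k).val < n) → (∀ k, (b.tgt k - x₀ k).val < n) → U b = U' b) →
              f U = f U') →
          (∀ U U' : GaugeField (F.P K) 0 (Matrix.specialUnitaryGroup (Fin 2) ℂ),
            |f U - f U'| ≤ Λ * Real.sqrt (∑ b : PBond (F.P K) 0, GaugeGroup.dist1 (U b * (U' b)⁻¹) ^ 2)) →
          ∀ r : ℝ, 0 ≤ r →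
            (gibbsK F ℰp γ K).real {U | r ≤ f U - ∫ V, f V ∂(gibbsK F ℰp γ K)} ≤
              Cc * Real.exp (-(cc * Real.sqrt ((F.scheme ℰp γ).β K) * r / ((n : ℝ) * Λ))))
    (hSM : ∀ (L : ℕ), ∃ C : ℝ, 0 ≤ C ∧ ∃ γ₁ : ℝ, 0 < γ₁ ∧ γ₁ ≤ 1 ∧ ∀ (F : T3Family) (γ : ℝ), F.L = L → 0 < γ → γ ≤ γ₁ →
          ∀ (K j : ℕ), 1 ≤ j → j ≤ K → ∀ a : Plaq (F.P K) j,
            ∫ U, (GaugeGroup.dist1 (GaugeField.plaqHol (Averaging.iter (fun i' => BlockAveraging.blockAvg (P := F.P K) (j := i') ℰp) j U) a)) ^ 2 ∂(gibbsK F ℰp γ K)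
              ≤ C * (γ * ((F.L : ℝ)⁻¹) ^ (K - j)))
    : Summit.QuantumFields.YangMills.Theses.UnitScaleTilt.HistoryTailL :=
  historyTailL_of_expConcentration_quantile hK1 blockLipschitzL_proof (quantileDeviation_of_secondMoment hSM)

end Summit.QuantumFields.YangMills.Theorems.PoincareLipschitzHistoryTailOfK1

end
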